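import Summits.Ventures.PercRepro.G3ClassA1
import Summits.Ventures.PercRepro.G3ClassA2
import Summits.Ventures.PercRepro.G3ClassA3
import Summits.Ventures.PercRepro.G3ClassB1
import Summits.Ventures.PercRepro.G3ClassB2
import Summits.Ventures.PercRepro.G3ClassB3

/-!
# The class sums of `g3`: every class outside the six specials is nonpositive (p6, gen 6)

Assembly of the chunk files `G3ClassA1..3.lean`, `G3ClassB1..3.lean` (gen 7 split of `G3ClassA/B`): `mem_group` (the sure-set groups cover
the subsets of `S3`, kernel), `classOK_all`, **`cT_nonpos`**.
-/

namespace PercRepro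

open Finset

/-- The sure-set groups cover the subsets of `S3` (kernel; a Bool chain, right-nested). -/
theorem mem_group : ∀ I : Finset (Fin 9), I ⊆ S3 → (decide (I ∈ iGroup0) || (decide (I ∈ iGroup1) || (decide (I ∈ iGroup2) || (decide (I ∈ iGroup3) || (decide (I ∈ iGroup4) || (decide (I ∈ iGroup5) || (decide (I ∈ iGroup6) || (decide (I ∈ iGroup7) || (decide (I ∈ iGroup8) || (decide (I ∈ iGroup9) || (decide (I ∈ iGroup10) || (decide (I ∈ iGroup11) || (decide (I ∈ iGroup12) || (decide (I ∈ iGroup13) || (decide (I ∈ iGroup14) || (decide (I ∈ iGroup15) || (decide (I ∈ iGroup16) || (decide (I ∈ iGroup17) || (decide (I ∈ iGroup18) || (decide (I ∈ iGroup19) || (decide (I ∈ iGroup20) || (decide (I ∈ iGroup21) || (decide (I ∈ iGroup22) || (decide (I ∈ iGroup23) || (decide (I ∈ iGroup24) || (decide (I ∈ iGroup25) || (decide (I ∈ iGroup26) || decide (I ∈ iGroup27)))))))))))))))))))))))))))) = true := by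
  decide +kernel

/-- **Every class is nonpositive outside the six specials** (kernel computation in chunks of ≤ 2200 evaluations: `65,536` values of `kA3`). -/
theorem classOK_all : ∀ I : Finset (Fin 9), I ⊆ S3 → ∀ U : Finset (Fin 9), U ⊆ S3 → classOKpair I U = true := by
  intro I hI U hU
  have h := mem_group I hI
  simp only [Bool.or_eq_true, decide_eq_true_eq] at h
  rcases h with h0 | h1 | h2 | h3 | h4 | h5 | h6 | h7 | h8 | h9 | h10 | h11 | h12 | h13 | h14 | h15 | h16 | h17 | h18 | h19 | h20 | h21 | h22 | h23 | h24 | h25 | h26 | h27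
  · exact classOK_0 I h0 U hU
  · exact classOK_1 I h1 U hU
  · exact classOK_2 I h2 U hU
  · exact classOK_3 I h3 U hU
  · exact classOK_4 I h4 U hU
  · exact classOK_5 I h5 U hU
  · exact classOK_6 I h6 U hU
  · exact classOK_7 I h7 U hU
  · exact classOK_8 I h8 U hU
  · exact classOK_9 I h9 U hU
  · exact classOK_10 I h10 U hU
  · exact classOK_11 I h11 U hU
  · exact classOK_12 I h12 U hU
  · exact classOK_13 I h13 U hU
  · exact classOK_14 I h14 U hU
  · exact classOK_15 I h15 U hU
  · exact classOK_16 I h16 U hU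
  · exact classOK_17 I h17 U hU
  · exact classOK_18 I h18 U hU
  · exact classOK_19 I h19 U hU
  · exact classOK_20 I h20 U hU
  · exact classOK_21 I h21 U hU
  · exact classOK_22 I h22 U hU
  · exact classOK_23 I h23 U hU
  · exact classOK_24 I h24 U hU
  · exact classOK_25 I h25 U hU
  · exact classOK_26 I h26 U hU
  · exact classOK_27 I h27 U hU

/-- **Every class outside the certificate is nonpositive.** -/
theorem cT_nonpos : ∀ I ∈ S3.powerset, ∀ U ∈ S3.powerset, I ⊆ U → (I, U) ∉ specials → cT I U ≤ 0 := by
  intro I hI U hU hIU hne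
  have h := classOK_all I (Finset.mem_powerset.mp hI) U (Finset.mem_powerset.mp hU)
  unfold classOKpair at h
  rw [Bool.or_eq_true, Bool.or_eq_true, Bool.not_eq_true', decide_eq_false_iff_not,
    decide_eq_true_eq, decide_eq_true_eq] at h
  rcases h with (h | h) | h
  · exact absurd hIU h
  · exact absurd h hne
  · exact h

end PercRepro
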